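/-
Copyright (c) 2026 the pub-hodgecm-mathlib formalisation cell (harness21).  Prover seat hodgecm-mathlib-K2E4-p07 (g0),
Track B «K2-LIT» ∕ h413, unit «FinGermConstants» of the line `K2_E4_SingularTransferKappaSign`, socket #7R
`K2E4SingularTransferKappaSign.FinGermConstants.sig_K2E3GermConstantRegularHR` (ED. 3), STEP 2a of its local residue: THE VALUE OF HARISH-CHANDRA'S
DESCENDED FUNCTION AT A CENTRALISED POINT IS NON-ZERO for the indicator of an open set through the orbit.  2026-09-03.
-/
import Literature.MeasureTheory.Group.OrbitalDescentFunction   -- ★ M2a: the descended function `m ↦ ∫ β(x) • ψ(x m x⁻¹) dν` (shape matched verbatim)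
import Literature.MeasureTheory.Group.ConjugationCutoff         -- ★ M1: Harish-Chandra's cut-off `β` (`β ≥ 0`, `∫_M β(x k) dρ(k) = 1` on `C·M`)
import Mathlib.MeasureTheory.Integral.Bochner.ContinuousLinearMap
import Mathlib.MeasureTheory.Measure.OpenPos
import HarnessLib

/-!
# K2_E4 road (h413 = stmt-HodgeConjecture-24833), socket #7R `sig_K2E3GermConstantRegularHR`, STEP 2a of the local residue:
# the descended function `ψ_M(m) = ∫_G β(x) • ψ(x m x⁻¹) dν(x)` of the INDICATOR `ψ = 1_V` does not vanish at `m` as soon as the cut-off charges one `x₀` with `x₀ m x₀⁻¹ ∈ V`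

Cell `pub/hodgecm-mathlib` (D-0151), Track B; socket **`sig_K2E3GermConstantRegularHR`** (FinGermConstants ED. 3, R-twin of #7; OWNER K2E3, base K2E4-p07).
After ★ `K2E3GermConstantRegularHUnitPair` (p854864: good places) and ★ `K2E3GermConstantRegularHRLocalReduction` (p854913: #7R at `v` ⟸ ONE local transfer pair near
`γ_{H,v}` WITH VALUE), the local statement at a non-split `v` with `W₂ ⊗ L_v` isotropic is the Harish-Chandra descent at the central singular point
(★ `LocalTransferCentralSingularDescentCM`: `φ^H := Δ₀ • (ψ_M ∘ θ)`, `ψ_M(m) = ∫ β(x) • ψ(x m x⁻¹) dν_{G′}`, `β` the cut-off of ★ M1 `ConjugationCutoff`) READ AT THE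
POINT `ε = θ(ε_H)`.  This file supplies the VALUE half in the exact currency of ★ M2a `OrbitalDescentFunction` (integrand `β x • ψ (x * m * x⁻¹)`, any measure `ν`
positive on open sets): for `ψ = 1_V` (`V` open) and a non-negative continuous compactly supported `β` with `β(x₀) > 0` at some `x₀` conjugating `m` into `V`,
`ψ_M(m) ≠ 0` (§1); and the cut-off's normalisation `∫_M β(x k) dρ(k) = 1` at a point `x` with `x m x⁻¹ ∈ V` PRODUCES such an `x₀ = x k` when `M` centralises `m`
(§2) — at the central singular point `m = ε ∈ Z(M)` take `x ∈ C·M` with `x ε x⁻¹ ∈ V`, e.g. `x ∈ M` when `C` meets `M`.  What remains for #7R's STEP 2 is the WITNESS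
threading through ★ D2ε ∕ the (R-inv) junction (they export `∃ψ_ε`, not `ψ_M ∘ θ` by name) — recorded on K2/STATUS.md (K2E4-p07, 2026-09-03T21:34:42Z).

THE MATHEMATICS.  `β(x) • 1_V(x m x⁻¹) = (1_S · β)(x)` with `S = {x | x m x⁻¹ ∈ V}` open; the real integral `∫_S β dν` is `> 0` because `β ≥ 0` is integrable
(continuous, compact support) and `{β > 0} ∩ S` is a non-empty OPEN set (it contains `x₀`), of positive measure for `ν` positive on opens
(Mathlib `setIntegral_pos_iff_support_of_nonneg_ae`); the complex integral is its image under `ℝ → ℂ`.  For §2: if `β(x k) = 0` for all `k ∈ M` the fibre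
integral `∫_M β(x k) dρ` would vanish. [HarishChandra1970, Part I §3 Lemmas 19–21; Rogawski1990 §8.2 p. 113.]

* §1 `integral_smul_indicator_conj_ne_zero` — `∫ β(x) • 1_V(x m x⁻¹) dν ≠ 0` from one `x₀` with `β x₀ > 0`, `x₀ m x₀⁻¹ ∈ V`.
* §2 `exists_pos_of_fiberIntegral_ne_zero`, `descended_indicator_ne_zero_of_fiberIntegral` — the `x₀` from the cut-off's normalisation when `M` centralises `m`.

HONEST LABEL: HC_CM is proved only modulo the 7 printed citations (2 remaining named inputs: hLiu418 = stmt-HodgeConjecture-24832, h413 =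
stmt-HodgeConjecture-24833) until rung 0 closes; this file is a `--supports stmt-HodgeConjecture-24833` helper (generic measure theory on a topological group)
and retires nothing by itself.
-/

set_option autoImplicit false
set_option linter.dupNamespace false

noncomputable section

open MeasureTheory Topology Set Filter Function

namespace Summit.HodgeConjecture.HodgeConjecture.Cruxes.H413.K2E3GermConstantRegularHRDescentValue

variable {G : Type*} [Group G] [TopologicalSpace G] [IsTopologicalGroup G] [MeasurableSpace G] [BorelSpace G]

/-! ## §1  The descended indicator does not vanish -/

/-- **`∫_G β(x) • 1_V(x m x⁻¹) dν(x) ≠ 0`** for `V` open, `β` continuous, compactly supported and non-negative, `ν` positive on open sets and finite on compacts, as soon as ONE point `x₀`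
has `β(x₀) > 0` and `x₀ m x₀⁻¹ ∈ V`: the integrand is `1_S · β` with `S = {x | x m x⁻¹ ∈ V}` open, and `{β > 0} ∩ S ∋ x₀` is a non-empty open set.
[cite: HarishChandra1970, Part I §3 Lemma 21] [cite: Rogawski1990, §8.2 p. 113] -/
theorem integral_smul_indicator_conj_ne_zero (ν : Measure G) [ν.IsOpenPosMeasure] [IsFiniteMeasureOnCompacts ν]
    {β : G → ℝ} (hβc : Continuous β) (hβs : HasCompactSupport β) (hβ0 : ∀ g, 0 ≤ β g)
    {V : Set G} (hV : IsOpen V) (m : G) {x₀ : G} (hx₀ : 0 < β x₀) (hx₀V : x₀ * m * x₀⁻¹ ∈ V) :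
    (∫ x, β x • V.indicator (fun _ => (1 : ℂ)) (x * m * x⁻¹) ∂ν) ≠ 0 := by
  -- the open set `S = {x | x m x⁻¹ ∈ V}`
  have hSo : IsOpen {x : G | x * m * x⁻¹ ∈ V} :=
    hV.preimage ((continuous_id.mul continuous_const).mul continuous_id.inv)
  -- the integrand is the complexification of `1_S · β`
  have hint : (fun x => β x • V.indicator (fun _ => (1 : ℂ)) (x * m * x⁻¹)) =
      fun x => (({x : G | x * m * x⁻¹ ∈ V}.indicator β x : ℝ) : ℂ) := by
    funext x
    by_cases hx : x * m * x⁻¹ ∈ V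
    · rw [Set.indicator_of_mem hx, Set.indicator_of_mem (show x ∈ {x : G | x * m * x⁻¹ ∈ V} from hx), Complex.real_smul, mul_one]
    · rw [Set.indicator_of_notMem hx, Set.indicator_of_notMem (show x ∉ {x : G | x * m * x⁻¹ ∈ V} from hx), smul_zero,
        Complex.ofReal_zero]
  rw [hint, integral_complex_ofReal, Complex.ofReal_ne_zero, integral_indicator hSo.measurableSet]
  -- positivity of the real set integral
  have hβi : IntegrableOn β {x : G | x * m * x⁻¹ ∈ V} ν := (hβc.integrable_of_hasCompactSupport hβs).integrableOn
  have hpos : 0 < ∫ x in {x : G | x * m * x⁻¹ ∈ V}, β x ∂ν := by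
    rw [setIntegral_pos_iff_support_of_nonneg_ae (Eventually.of_forall fun g => hβ0 g) hβi]
    have hopen : IsOpen (support β ∩ {x : G | x * m * x⁻¹ ∈ V}) := by
      rw [support_eq_preimage]
      exact (isOpen_compl_singleton.preimage hβc).inter hSo
    exact hopen.measure_pos ν ⟨x₀, Function.mem_support.2 hx₀.ne', hx₀V⟩
  exact hpos.ne'

/-! ## §2  The point `x₀` from the cut-off's normalisation, when `M` centralises `m` -/

omit [TopologicalSpace G] [IsTopologicalGroup G] [MeasurableSpace G] [BorelSpace G] in
/-- **A non-zero fibre integral charges a point**: if `∫_M β(x k) dρ(k) ≠ 0` then `β(x k) > 0` for some `k ∈ M` (for `β ≥ 0`).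
[cite: HarishChandra1970, Part I §3 (proof of Lemma 19)] -/
theorem exists_pos_of_fiberIntegral_ne_zero (M : Subgroup G) [MeasurableSpace M] (ρ : Measure M) {β : G → ℝ} (hβ0 : ∀ g, 0 ≤ β g) {x : G}
    (h : (∫ k : M, β (x * (k : G)) ∂ρ) ≠ 0) : ∃ k : M, 0 < β (x * (k : G)) := by
  by_contra hne
  refine h (integral_eq_zero_of_ae (Eventually.of_forall fun k => ?_))
  have hk : ¬ 0 < β (x * (k : G)) := fun hk => hne ⟨k, hk⟩
  exact le_antisymm (not_lt.1 hk) (hβ0 _)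

/-- **The descended indicator charges a centralised point.**  `M ≤ G` centralising `m` (`k m = m k` for `k ∈ M`), `β ≥ 0` continuous with compact support and fibre
integral `∫_M β(x k) dρ(k) ≠ 0` at a point `x` with `x m x⁻¹ ∈ V` (for Harish-Chandra's cut-off of ★ `ConjugationCutoff` this holds on `C·M`), `V` open, `ν` positive on
open sets: `∫_G β(y) • 1_V(y m y⁻¹) dν(y) ≠ 0` — the value at `m` of ★ `OrbitalDescentFunction`'s descended function of `ψ = 1_V`.  At the central singular point of
[Rogawski1990, Prop. 8.2.1] (`m = ε` central in `M = Z(ε)`) this is the non-vanishing of `φ_ε(ε_H)` for `φ = 1_V`, `V ∋ ε`.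
[cite: HarishChandra1970, Part I §3 Lemmas 19–21] [cite: Rogawski1990, §8.2 Prop. 8.2.1 p. 113] -/
theorem descended_indicator_ne_zero_of_fiberIntegral (ν : Measure G) [ν.IsOpenPosMeasure] [IsFiniteMeasureOnCompacts ν] (M : Subgroup G) [MeasurableSpace M] (ρ : Measure M)
    {m : G} (hM : ∀ k ∈ M, k * m = m * k)
    {β : G → ℝ} (hβc : Continuous β) (hβs : HasCompactSupport β) (hβ0 : ∀ g, 0 ≤ β g)
    {V : Set G} (hV : IsOpen V) {x : G} (hxV : x * m * x⁻¹ ∈ V) (hx : (∫ k : M, β (x * (k : G)) ∂ρ) ≠ 0) :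
    (∫ y, β y • V.indicator (fun _ => (1 : ℂ)) (y * m * y⁻¹) ∂ν) ≠ 0 := by
  obtain ⟨k, hk⟩ := exists_pos_of_fiberIntegral_ne_zero M ρ hβ0 hx
  refine integral_smul_indicator_conj_ne_zero ν hβc hβs hβ0 hV m hk ?_
  have hkm : (k : G) * m * (k : G)⁻¹ = m := by
    rw [hM _ k.2, mul_inv_cancel_right]
  have e : x * (k : G) * m * (x * (k : G))⁻¹ = x * m * x⁻¹ := by
    rw [mul_inv_rev, ← mul_assoc, mul_assoc x (k : G) m, mul_assoc x ((k : G) * m) ((k : G)⁻¹), hkm]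
  rw [e]
  exact hxV

end Summit.HodgeConjecture.HodgeConjecture.Cruxes.H413.K2E3GermConstantRegularHRDescentValue

end
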